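import Mathlib
import Literature.NumberTheory.LFunctions.Zhang2022.TypedAppendixA1
import Literature.NumberTheory.LFunctions.Zhang2022.AppendixALemma83Local
import Literature.NumberTheory.LFunctions.Zhang2022.AppendixALemma83Kappa
import Literature.NumberTheory.LFunctions.Zhang2022.AppendixALemma83LocalEstimates
import Literature.NumberTheory.LFunctions.Zhang2022.AppendixALemma83Discharge
import HarnessLib

/-!
# Zhang (2022), Appendix A part 1 (proof of Lemma 8.3): the `q^{−rs}`-weighted sums of Cases 2–3
# (Z22:§A.u017, u019) and the deductions (A.2), (A.3) — kernel-checked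

Topic `Literature/NumberTheory/LFunctions/Zhang2022` (Landau–Siegel audit tree; verdict-neutral).
Y. Zhang, *Discrete mean estimates and the Landau–Siegel zero*, arXiv:2211.02515v1 (2022)
[Zhang2022LandauSiegel], Appendix A pp. 102–103 (tex L5055–L5083), **an unrefereed manuscript under
adjudication**. For a prime `q ∣ h` (Case 2) resp. `q ∣ d`, `(q,h) = 1` (Case 3), with
`|s − 1| < 5α`, `q < D`, the series `Σ_{r≥1} χ(q^r)ξ_j(q^r;d,h)q^{−rs}` (`Typed.AppendixA1.xiPowSum`)
is a power series in `vX`, `v = χ(q)`, `X = q^{−s}`, with coefficients `κ(q^r)` resp.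
`κ(q^r) − κ(q^{r−1})q^{1−β_j}/(q−1)`, which are within `O(α r² log q)` of `r + 1` resp.
`r + 1 − r/(1−u)` (`AppendixALemma83Kappa`); and `X` is within `q⁻¹·10α log q` of `u = q⁻¹`.
This file PROVES the typed nodes

* `stepA_u017_holds` — **Z22:§A.u017**: `Σ_r χ(q^r)ξ_j(q^r;d,h)/q^{rs} = 1/(1−vu)² − 1 + O(α log q/q)`;
* `stepA_u019_holds` — **Z22:§A.u019**: `… = 1/(1−vu)² − 1 − vu/((1−u)(1−vu)²) + O(α log q/q)`;
* `dedA2_holds`, `dedA3_holds` — the printed deductions "this yields (A.2)/(A.3)" (`DedA2`, `DedA3`: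
  algebra of `𝔱_j = pref·(1 + λ̃·Σ)` with `λ̃ = 1`);
* hence **(A.2) and (A.3) hold**: `eqA_2_holds : EqA_2 c′`, `eqA_3_holds : EqA_3 c′`,

with explicit absolute constants, for `D` large in terms of `c′` (Assumption (A) carried vacuously,
as in the nodes). Case 1 ((A.1), u012–u013) is in a companion file. Nothing here bears on
Theorems 1–2 of the manuscript.

## References

* Y. Zhang, arXiv:2211.02515v1 (2022), Appendix A pp. 102–103. [cite: Zhang2022LandauSiegel, App. A]
-/

noncomputable section

open Complex Real ComplexConjugate Finset

namespace Literature.NumberTheory.LFunctions.Zhang2022.Lemma83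

open Literature.NumberTheory.LFunctions.Zhang2022
open Literature.NumberTheory.LFunctions.Zhang2022.Skeleton
open Literature.NumberTheory.LFunctions.Zhang2022.MeanSquareMajorant
open Literature.NumberTheory.LFunctions.Zhang2022.Typed.AppendixA1

/-! ## Geometric sums with a shifted index -/

/-- `Σ_{r≥0} Z^{r+1} = 1/(1−Z) − 1` for `‖Z‖ < 1`. [folklore] -/
private theorem hasSum_pow_succ {Z : ℂ} (hZ : ‖Z‖ < 1) :
    HasSum (fun r : ℕ => Z ^ (r + 1)) (1 / (1 - Z) - 1) := by
  have h1 : 1 - Z ≠ 0 := sub_ne_zero.mpr (fun h => by rw [← h, norm_one] at hZ; exact lt_irrefl _ hZ)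
  have h := (hasSum_geometric_of_norm_lt_one hZ).mul_left Z
  simp only [← pow_succ'] at h
  have e : Z * (1 - Z)⁻¹ = 1 / (1 - Z) - 1 := by field_simp; ring
  rwa [e] at h

/-- `Σ_{r≥0} (r+1)Z^{r+1} = Z/(1−Z)²` for `‖Z‖ < 1`. [folklore] -/
private theorem hasSum_coe_succ_mul_pow_succ {Z : ℂ} (hZ : ‖Z‖ < 1) :
    HasSum (fun r : ℕ => ((r : ℂ) + 1) * Z ^ (r + 1)) (Z / (1 - Z) ^ 2) := by
  have h := hasSum_coe_mul_geometric_of_norm_lt_one hZ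
  rw [← hasSum_nat_add_iff' 1] at h
  simp only [Finset.range_one, Finset.sum_singleton, Nat.cast_zero, zero_mul, sub_zero,
    Nat.cast_add, Nat.cast_one] at h
  exact h

/-- `Σ_{r≥0} (r+2)Z^{r+1} = 1/(1−Z)² − 1` for `‖Z‖ < 1`. [folklore] -/
private theorem hasSum_coe_add_two_mul_pow_succ {Z : ℂ} (hZ : ‖Z‖ < 1) :
    HasSum (fun r : ℕ => ((r : ℂ) + 2) * Z ^ (r + 1)) (1 / (1 - Z) ^ 2 - 1) := by
  have h1 : 1 - Z ≠ 0 := sub_ne_zero.mpr (fun h => by rw [← h, norm_one] at hZ; exact lt_irrefl _ hZ)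
  have h := (hasSum_coe_succ_mul_pow_succ hZ).add (hasSum_pow_succ hZ)
  have e : Z / (1 - Z) ^ 2 + (1 / (1 - Z) - 1) = 1 / (1 - Z) ^ 2 - 1 := by field_simp; ring
  rw [e] at h
  convert h using 1
  ext r; ring

/-! ## Polynomial growth against a geometric factor -/

/-- `(r+2)² ≤ 9·(3/2)^r`. [folklore] -/
private theorem sq_le_nine_mul_pow (r : ℕ) : ((r : ℝ) + 2) ^ 2 ≤ 9 * (3 / 2 : ℝ) ^ r := by
  have step : ∀ n : ℕ, 3 ≤ n → ((n : ℝ) + 2) ^ 2 ≤ 9 * (3 / 2 : ℝ) ^ n →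
      (((n + 1 : ℕ) : ℝ) + 2) ^ 2 ≤ 9 * (3 / 2 : ℝ) ^ (n + 1) := by
    intro n hn ih
    have hn' : (3 : ℝ) ≤ n := by exact_mod_cast hn
    have key : ((n : ℝ) + 1 + 2) ^ 2 ≤ (3 / 2) * ((n : ℝ) + 2) ^ 2 := by nlinarith
    calc (((n + 1 : ℕ) : ℝ) + 2) ^ 2 = ((n : ℝ) + 1 + 2) ^ 2 := by push_cast; ring
      _ ≤ (3 / 2) * ((n : ℝ) + 2) ^ 2 := key
      _ ≤ (3 / 2) * (9 * (3 / 2 : ℝ) ^ n) := by gcongr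
      _ = 9 * (3 / 2 : ℝ) ^ (n + 1) := by ring
  rcases Nat.lt_or_ge r 3 with hr | hr
  · interval_cases r <;> norm_num
  · induction r, hr using Nat.le_induction with
    | base => norm_num
    | succ n hn ih => exact step n hn ih

/-- Weighted power sums with polynomially controlled coefficients: if `‖Z‖ ≤ 3/5` and
`‖f(r)‖ ≤ E(r+2)²` then `Σ_r Z^{r+1}f(r)` converges absolutely and is `≤ 90E‖Z‖` in norm.
[folklore] -/
private theorem tsum_pow_succ_mul_bound {Z : ℂ} (hZ : ‖Z‖ ≤ 3 / 5) {f : ℕ → ℂ} {E : ℝ}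
    (hE : 0 ≤ E) (hf : ∀ r : ℕ, ‖f r‖ ≤ E * ((r : ℝ) + 2) ^ 2) :
    Summable (fun r : ℕ => Z ^ (r + 1) * f r) ∧ ‖∑' r : ℕ, Z ^ (r + 1) * f r‖ ≤ 90 * E * ‖Z‖ := by
  have hterm : ∀ r : ℕ, ‖Z ^ (r + 1) * f r‖ ≤ 9 * E * ‖Z‖ * (9 / 10 : ℝ) ^ r := fun r => by
    rw [norm_mul, norm_pow, pow_succ]
    have h1 : ‖Z‖ ^ r ≤ (3 / 5 : ℝ) ^ r := pow_le_pow_left₀ (norm_nonneg _) hZ r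
    have h2 := sq_le_nine_mul_pow r
    calc ‖Z‖ ^ r * ‖Z‖ * ‖f r‖ ≤ (3 / 5 : ℝ) ^ r * ‖Z‖ * (E * ((r : ℝ) + 2) ^ 2) := by
          gcongr; exact hf r
      _ ≤ (3 / 5 : ℝ) ^ r * ‖Z‖ * (E * (9 * (3 / 2 : ℝ) ^ r)) := by gcongr
      _ = 9 * E * ‖Z‖ * ((3 / 5 : ℝ) ^ r * (3 / 2) ^ r) := by ring
      _ = 9 * E * ‖Z‖ * (9 / 10 : ℝ) ^ r := by rw [← mul_pow]; norm_num
  have hgeo : HasSum (fun r : ℕ => 9 * E * ‖Z‖ * (9 / 10 : ℝ) ^ r) (9 * E * ‖Z‖ * 10) := by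
    have h := (hasSum_geometric_of_lt_one (by norm_num : (0 : ℝ) ≤ 9 / 10) (by norm_num)).mul_left
      (9 * E * ‖Z‖)
    have e : 9 * E * ‖Z‖ * (1 - 9 / 10 : ℝ)⁻¹ = 9 * E * ‖Z‖ * 10 := by norm_num
    rwa [e] at h
  have hsum : Summable (fun r : ℕ => Z ^ (r + 1) * f r) :=
    Summable.of_norm_bounded hgeo.summable hterm
  refine ⟨hsum, ?_⟩
  calc ‖∑' r : ℕ, Z ^ (r + 1) * f r‖ ≤ 9 * E * ‖Z‖ * 10 := tsum_of_norm_bounded hgeo hterm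
    _ = 90 * E * ‖Z‖ := by ring

/-! ## Lipschitz bounds on the disc `‖·‖ ≤ 3/5` -/

/-- `‖1/(1−a) − 1/(1−b)‖ ≤ (25/4)‖a − b‖` for `‖a‖, ‖b‖ ≤ 3/5`. [folklore] -/
private theorem norm_inv_sub_inv_le {a b : ℂ} (ha : ‖a‖ ≤ 3 / 5) (hb : ‖b‖ ≤ 3 / 5) :
    ‖1 / (1 - a) - 1 / (1 - b)‖ ≤ 25 / 4 * ‖a - b‖ := by
  have hna : 2 / 5 ≤ ‖1 - a‖ := by
    linarith [norm_le_norm_add_norm_sub' (1 : ℂ) a, norm_one (α := ℂ)]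
  have hnb : 2 / 5 ≤ ‖1 - b‖ := by
    linarith [norm_le_norm_add_norm_sub' (1 : ℂ) b, norm_one (α := ℂ)]
  have ha0 : 1 - a ≠ 0 := fun h => by rw [h, norm_zero] at hna; linarith
  have hb0 : 1 - b ≠ 0 := fun h => by rw [h, norm_zero] at hnb; linarith
  have e : 1 / (1 - a) - 1 / (1 - b) = (a - b) / ((1 - a) * (1 - b)) := by field_simp; ring
  rw [e, norm_div, norm_mul]
  rw [div_le_iff₀ (by positivity)]
  nlinarith [norm_nonneg (a - b), mul_le_mul hna hnb (by norm_num) (norm_nonneg _)]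

/-- `‖1/(1−a)² − 1/(1−b)²‖ ≤ 125‖a − b‖` for `‖a‖, ‖b‖ ≤ 3/5`. [folklore] -/
private theorem norm_inv_sq_sub_inv_sq_le {a b : ℂ} (ha : ‖a‖ ≤ 3 / 5) (hb : ‖b‖ ≤ 3 / 5) :
    ‖1 / (1 - a) ^ 2 - 1 / (1 - b) ^ 2‖ ≤ 125 * ‖a - b‖ := by
  have hna : 2 / 5 ≤ ‖1 - a‖ := by
    linarith [norm_le_norm_add_norm_sub' (1 : ℂ) a, norm_one (α := ℂ)]
  have hnb : 2 / 5 ≤ ‖1 - b‖ := by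
    linarith [norm_le_norm_add_norm_sub' (1 : ℂ) b, norm_one (α := ℂ)]
  have ha0 : 1 - a ≠ 0 := fun h => by rw [h, norm_zero] at hna; linarith
  have hb0 : 1 - b ≠ 0 := fun h => by rw [h, norm_zero] at hnb; linarith
  have e : 1 / (1 - a) ^ 2 - 1 / (1 - b) ^ 2 =
      (a - b) * (2 - a - b) / ((1 - a) ^ 2 * (1 - b) ^ 2) := by field_simp; ring
  have h2ab : ‖2 - a - b‖ ≤ 16 / 5 := by
    calc ‖2 - a - b‖ ≤ ‖(2 : ℂ) - a‖ + ‖b‖ := norm_sub_le _ _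
      _ ≤ ‖(2 : ℂ)‖ + ‖a‖ + ‖b‖ := by linarith [norm_sub_le (2 : ℂ) a]
      _ ≤ 16 / 5 := by rw [Complex.norm_two]; linarith
  have hden : (2 / 5 : ℝ) ^ 2 * (2 / 5) ^ 2 ≤ ‖1 - a‖ ^ 2 * ‖1 - b‖ ^ 2 :=
    mul_le_mul (pow_le_pow_left₀ (by norm_num) hna 2) (pow_le_pow_left₀ (by norm_num) hnb 2)
      (by positivity) (by positivity)
  rw [e, norm_div, norm_mul, norm_mul, norm_pow, norm_pow, div_le_iff₀ (by positivity)]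
  nlinarith [norm_nonneg (a - b), mul_le_mul_of_nonneg_left h2ab (norm_nonneg (a - b))]

/-- `‖a/(1−a)² − b/(1−b)²‖ ≤ 82‖a − b‖` for `‖a‖, ‖b‖ ≤ 3/5`. [folklore] -/
private theorem norm_div_sq_sub_div_sq_le {a b : ℂ} (ha : ‖a‖ ≤ 3 / 5) (hb : ‖b‖ ≤ 3 / 5) :
    ‖a / (1 - a) ^ 2 - b / (1 - b) ^ 2‖ ≤ 82 * ‖a - b‖ := by
  have hna : 2 / 5 ≤ ‖1 - a‖ := by
    linarith [norm_le_norm_add_norm_sub' (1 : ℂ) a, norm_one (α := ℂ)]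
  have ha0 : 1 - a ≠ 0 := fun h => by rw [h, norm_zero] at hna; linarith
  have e : a / (1 - a) ^ 2 - b / (1 - b) ^ 2 =
      (a - b) * (1 / (1 - a) ^ 2) + b * (1 / (1 - a) ^ 2 - 1 / (1 - b) ^ 2) := by
    ring
  have hinv : ‖1 / (1 - a) ^ 2‖ ≤ 25 / 4 := by
    rw [norm_div, norm_one, norm_pow, div_le_iff₀ (by positivity)]
    nlinarith [pow_le_pow_left₀ (by norm_num : (0:ℝ) ≤ 2 / 5) hna 2]
  rw [e]
  calc _ ≤ ‖(a - b) * (1 / (1 - a) ^ 2)‖ + ‖b * (1 / (1 - a) ^ 2 - 1 / (1 - b) ^ 2)‖ :=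
        norm_add_le _ _
    _ ≤ ‖a - b‖ * (25 / 4) + 3 / 5 * (125 * ‖a - b‖) := by
        rw [norm_mul, norm_mul]
        exact add_le_add (mul_le_mul_of_nonneg_left hinv (norm_nonneg _))
          (mul_le_mul hb (norm_inv_sq_sub_inv_sq_le ha hb) (norm_nonneg _) (by norm_num))
    _ ≤ 82 * ‖a - b‖ := by nlinarith [norm_nonneg (a - b)]

/-! ## The series `xiPowSum` as a power series in `vX` -/

/-- `Σ_r χ(q^r)ξ_j(q^r;d,h)/q^{rs} = Σ_{r≥0} (χ(q)q^{−s})^{r+1} ξ_j(q^{r+1};d,h)` (`χ` completely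
multiplicative, `q^{(r+1)s} = (q^s)^{r+1}`). [cite: Zhang2022LandauSiegel, App. A p. 101] -/
theorem xiPowSum_eq (c' : ℝ) {D : ℕ} (χ : DirichletCharacter ℂ D) (j d h : ℕ) (s : ℂ) {q : ℕ}
    (hq : 0 < q) :
    xiPowSum c' χ j d h s q =
      ∑' r : ℕ, (χ (q : ZMod D) * (q : ℂ) ^ (-s)) ^ (r + 1) * xiA c' D j (q ^ (r + 1)) d h := by
  unfold xiPowSum
  refine tsum_congr fun r => ?_
  have hq0 : (q : ℂ) ≠ 0 := by exact_mod_cast hq.ne'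
  rw [Nat.cast_pow, map_pow, Complex.cpow_nat_mul, Complex.cpow_neg, mul_pow, div_eq_mul_inv,
    ← inv_pow]
  ring

/-! ## The common frame under `|s − 1| < 5α`, `q < D` -/

/-- Under the standing conditions of App. A (`|s−1| < 5α`, `q < D`, `q` prime) and for `D` large:
`X = q^{−s}` satisfies `‖X − u‖ ≤ 10α log q · u` and `‖X‖ ≤ 3/5`, where `u = q⁻¹ ≤ 1/2`.
[cite: Zhang2022LandauSiegel, App. A p. 102] -/
theorem frame_X (c' : ℝ) {D : ℕ} (hD : Real.exp (10 * |c'| * π + 400) ≤ D) {q : ℕ} (hq : q.Prime)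
    (hqD : q < D) {s : ℂ} (hs : ‖s - 1‖ < 5 * alpha D) :
    ‖(q : ℂ) ^ (-s) - (q : ℂ)⁻¹‖ ≤ 10 * alpha D * Real.log q * (q : ℝ)⁻¹ ∧
      ‖(q : ℂ) ^ (-s)‖ ≤ 3 / 5 ∧ ‖((q : ℂ))⁻¹‖ ≤ 1 / 2 ∧ (q : ℝ)⁻¹ ≤ 1 / 2 ∧
      Real.log q ≤ ell D ∧ 0 ≤ Real.log q := by
  obtain ⟨hℓ3, hα, _, hαℓ⟩ := largeD_bounds c' hD
  have hq2 : (2 : ℝ) ≤ q := by exact_mod_cast hq.two_le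
  have hq0 : (0 : ℝ) < q := by linarith
  have hlogq : Real.log q ≤ ell D := by
    rw [ell]; exact Real.log_le_log hq0 (by exact_mod_cast hqD.le)
  have hlogq0 : 0 ≤ Real.log q := Real.log_nonneg (by linarith)
  have hqinv : (q : ℝ)⁻¹ ≤ 1 / 2 := inv_le_of_inv_le₀ (by norm_num) (by linarith)
  have hu : ‖((q : ℂ))⁻¹‖ ≤ 1 / 2 := by rw [norm_inv, Complex.norm_natCast]; exact hqinv
  have hs' : ‖1 - s‖ ≤ 5 * alpha D := by rw [← norm_neg, neg_sub]; exact hs.le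
  have hcond : ‖1 - s‖ * Real.log q ≤ 1 := by
    calc ‖1 - s‖ * Real.log q ≤ 5 * alpha D * ell D := mul_le_mul hs' hlogq hlogq0 (by positivity)
      _ ≤ 1 := by nlinarith
  have hq0' : (q : ℂ) ≠ 0 := by exact_mod_cast hq.ne_zero
  have hX : ‖(q : ℂ) ^ (-s) - (q : ℂ)⁻¹‖ ≤ 10 * alpha D * Real.log q * (q : ℝ)⁻¹ := by
    have e : -s = -1 + (1 - s) := by ring
    rw [e, Complex.cpow_add _ _ hq0', Complex.cpow_neg_one, ← mul_sub_one, norm_mul, norm_inv,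
      Complex.norm_natCast]
    have h1 : ‖(q : ℂ) ^ (1 - s) - 1‖ ≤ 2 * ‖1 - s‖ * Real.log q := by
      have hlog : Complex.log (q : ℂ) = (Real.log q : ℂ) := (Complex.natCast_log).symm
      rw [Complex.cpow_def_of_ne_zero hq0', hlog]
      have hz : ‖(Real.log q : ℂ) * (1 - s)‖ = ‖1 - s‖ * Real.log q := by
        rw [norm_mul, Complex.norm_real, Real.norm_eq_abs, abs_of_nonneg hlogq0, mul_comm]
      calc ‖Complex.exp ((Real.log q : ℂ) * (1 - s)) - 1‖ ≤ 2 * ‖(Real.log q : ℂ) * (1 - s)‖ :=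
            Complex.norm_exp_sub_one_le (by rw [hz]; exact hcond)
        _ = 2 * ‖1 - s‖ * Real.log q := by rw [hz]; ring
    calc (q : ℝ)⁻¹ * ‖(q : ℂ) ^ (1 - s) - 1‖ ≤ (q : ℝ)⁻¹ * (2 * (5 * alpha D) * Real.log q) := by
          apply mul_le_mul_of_nonneg_left _ (by positivity)
          calc _ ≤ 2 * ‖1 - s‖ * Real.log q := h1
            _ ≤ 2 * (5 * alpha D) * Real.log q := by gcongr
      _ = 10 * alpha D * Real.log q * (q : ℝ)⁻¹ := by ring
  have hXn : ‖(q : ℂ) ^ (-s)‖ ≤ 3 / 5 := by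
    have h1 : ‖(q : ℂ) ^ (-s)‖ ≤ ‖(q : ℂ) ^ (-s) - (q : ℂ)⁻¹‖ + ‖((q : ℂ))⁻¹‖ := by
      have := norm_add_le ((q : ℂ) ^ (-s) - (q : ℂ)⁻¹) ((q : ℂ))⁻¹
      rwa [sub_add_cancel] at this
    have h2 : 10 * alpha D * Real.log q * (q : ℝ)⁻¹ ≤ 10 * (alpha D * ell D) * (1 / 2) := by
      calc 10 * alpha D * Real.log q * (q : ℝ)⁻¹ ≤ 10 * alpha D * ell D * (1 / 2) := by gcongr
        _ = 10 * (alpha D * ell D) * (1 / 2) := by ring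
    linarith
  exact ⟨hX, hXn, hu, hqinv, hlogq, hlogq0⟩

/-- `‖q^{−β_j} − 1‖ ≤ ‖β_j‖ log q` (purely imaginary exponent: `q^{−β_j} = e^{−i b log q}`).
[cite: Zhang2022LandauSiegel, App. A p. 102] -/
theorem norm_cpow_neg_betaJ_sub_one_le (c' : ℝ) (D : ℕ) (j : ℕ) {q : ℕ} (hq : 0 < q) :
    ‖(q : ℂ) ^ (-betaJ c' D j) - 1‖ ≤ ‖betaJ c' D j‖ * Real.log q := by
  have hq0 : (q : ℂ) ≠ 0 := by exact_mod_cast hq.ne'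
  have hre : (betaJ c' D j).re = 0 := by
    unfold betaJ beta1 beta2 beta3; split_ifs <;> simp
  have him : -betaJ c' D j = ((-(betaJ c' D j).im : ℝ) : ℂ) * I := by
    apply Complex.ext <;> simp [hre]
  rw [Complex.cpow_def_of_ne_zero hq0, ← Complex.natCast_log, him]
  have e : (Real.log q : ℂ) * (((-(betaJ c' D j).im : ℝ) : ℂ) * I) =
      I * ((Real.log q * (-(betaJ c' D j).im) : ℝ) : ℂ) := by push_cast; ring
  rw [e]
  calc ‖Complex.exp (I * ((Real.log q * (-(betaJ c' D j).im) : ℝ) : ℂ)) - 1‖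
      ≤ ‖(Real.log q * (-(betaJ c' D j).im) : ℝ)‖ := Real.norm_exp_I_mul_ofReal_sub_one_le
    _ = ‖betaJ c' D j‖ * Real.log q := by
        have hn : ‖betaJ c' D j‖ = |(betaJ c' D j).im| := by
          have e2 : betaJ c' D j = ((betaJ c' D j).im : ℂ) * I := by
            apply Complex.ext <;> simp [hre]
          rw [congrArg (fun z : ℂ => ‖z‖) e2]
          simp
        rw [Real.norm_eq_abs, abs_mul, abs_of_nonneg (Real.log_natCast_nonneg q), abs_neg,
          mul_comm, hn]

/-! ## Case 2: Z22:§A.u017 -/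

/-- **Z22:§A.u017 holds** (App. A p. 103, tex L5066): for `q ∣ h` (Case 2, `ξ_j(q^r;d,h) = κ(q^r)`),
`|s − 1| < 5α`, `q < D`: `‖Σ_r χ(q^r)ξ_j(q^r;d,h)/q^{rs} − (1/(1−vu)² − 1)‖ ≤ 2600·α log q/q` for
all large `D`. [cite: Zhang2022LandauSiegel, App. A p. 103] -/
theorem stepA_u017_holds (c' : ℝ) : StepA_u017 c' := by
  refine ⟨2600, ⌈Real.exp (10 * |c'| * π + 400)⌉₊,
    fun D _ χ hD _ _ _ j _ d h hd hh _ q hq s hcond hqh => ?_⟩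
  have hD' : Real.exp (10 * |c'| * π + 400) ≤ D := le_trans (Nat.le_ceil _) (by exact_mod_cast hD)
  obtain ⟨hℓ3, hα, hB, hαℓ⟩ := largeD_bounds c' hD'
  obtain ⟨hs, hqD, _⟩ := hcond
  obtain ⟨hXu, hXn, hun, hqinv, hlogq, hlogq0⟩ := frame_X c' hD' hq hqD hs
  set B : ℝ := |b1 c' D| + |b2 c' D| + |b3 c' D| with hBdef
  set v : ℂ := χ (q : ZMod D) with hv
  set X : ℂ := (q : ℂ) ^ (-s) with hX
  set u : ℂ := ((q : ℂ))⁻¹ with hu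
  have hvn : ‖v‖ ≤ 1 := χ.norm_le_one _
  have hvX : ‖v * X‖ ≤ 3 / 5 := by
    rw [norm_mul]; nlinarith [norm_nonneg v, norm_nonneg X]
  have hvu : ‖v * u‖ ≤ 3 / 5 := by
    rw [norm_mul]; nlinarith [norm_nonneg v, norm_nonneg u]
  have hvXu : ‖v * X - v * u‖ ≤ 10 * alpha D * Real.log q * (q : ℝ)⁻¹ := by
    rw [← mul_sub, norm_mul]; nlinarith [norm_nonneg v, norm_nonneg (X - u)]
  have hvX2 : ‖v * X‖ ≤ 2 * (q : ℝ)⁻¹ := by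
    have h1 : ‖X‖ ≤ ‖X - u‖ + ‖u‖ := by
      have := norm_add_le (X - u) u; rwa [sub_add_cancel] at this
    have h2 : ‖u‖ = (q : ℝ)⁻¹ := by rw [hu, norm_inv, Complex.norm_natCast]
    have h3 : 10 * alpha D * Real.log q * (q : ℝ)⁻¹ ≤ (q : ℝ)⁻¹ := by
      have : 10 * alpha D * Real.log q ≤ 10 * (alpha D * ell D) := by
        calc _ ≤ 10 * alpha D * ell D := by gcongr
          _ = _ := by ring
      have hq0' : (0 : ℝ) ≤ (q : ℝ)⁻¹ := by positivity
      nlinarith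
    calc ‖v * X‖ ≤ ‖X‖ := by rw [norm_mul]; nlinarith [norm_nonneg v, norm_nonneg X]
      _ ≤ 2 * (q : ℝ)⁻¹ := by linarith
  -- the coefficients: `ξ_j(q^{r+1};d,h) = κ(q^{r+1})`
  have hxi : ∀ r : ℕ, xiA c' D j (q ^ (r + 1)) d h = kappaZ c' D (q ^ (r + 1)) := fun r =>
    stepA_u016_eq_holds c' D j d h q (r + 1) hd hh hq hqh (by omega)
  -- the series
  rw [xiPowSum_eq c' χ j d h s hq.pos]
  have hsplit : ∀ r : ℕ, (v * X) ^ (r + 1) * xiA c' D j (q ^ (r + 1)) d h =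
      ((r : ℂ) + 2) * (v * X) ^ (r + 1) +
        (v * X) ^ (r + 1) * (kappaZ c' D (q ^ (r + 1)) - ((r : ℂ) + 2)) := fun r => by
    rw [hxi r]; ring
  have hE : ∀ r : ℕ, ‖kappaZ c' D (q ^ (r + 1)) - ((r : ℂ) + 2)‖ ≤
      (B * Real.log q) * ((r : ℝ) + 2) ^ 2 := fun r => by
    have h := norm_kappa_prime_pow_sub_le (b1 c' D) (b2 c' D) (b3 c' D) hq (r + 1)
    rw [kappaZ]
    have e1 : (((r + 1 : ℕ) : ℂ) + 1) = (r : ℂ) + 2 := by push_cast; ring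
    rw [e1] at h
    calc _ ≤ ((r + 1 : ℕ) + 1) * (r + 1 : ℕ) * B * Real.log q := h
      _ ≤ (B * Real.log q) * ((r : ℝ) + 2) ^ 2 := by
          push_cast
          have hB0 : 0 ≤ B * Real.log q := by positivity
          nlinarith
  obtain ⟨hsumR, hR⟩ := tsum_pow_succ_mul_bound hvX (by positivity) hE
  have hmain := hasSum_coe_add_two_mul_pow_succ (lt_of_le_of_lt hvX (by norm_num))
  have htot : ∑' r : ℕ, (v * X) ^ (r + 1) * xiA c' D j (q ^ (r + 1)) d h =
      (1 / (1 - v * X) ^ 2 - 1) +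
        ∑' r : ℕ, (v * X) ^ (r + 1) * (kappaZ c' D (q ^ (r + 1)) - ((r : ℂ) + 2)) := by
    rw [tsum_congr hsplit, hmain.summable.tsum_add hsumR, hmain.tsum_eq]
  rw [htot]
  have huA : uA q = u := rfl
  have hvA : vA χ q = v := rfl
  rw [huA, hvA]
  have e : (1 / (1 - v * X) ^ 2 - 1) +
      ∑' r : ℕ, (v * X) ^ (r + 1) * (kappaZ c' D (q ^ (r + 1)) - ((r : ℂ) + 2)) -
      (1 / (1 - v * u) ^ 2 - 1) =
      (1 / (1 - v * X) ^ 2 - 1 / (1 - v * u) ^ 2) +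
        ∑' r : ℕ, (v * X) ^ (r + 1) * (kappaZ c' D (q ^ (r + 1)) - ((r : ℂ) + 2)) := by ring
  rw [e]
  calc _ ≤ ‖1 / (1 - v * X) ^ 2 - 1 / (1 - v * u) ^ 2‖ +
        ‖∑' r : ℕ, (v * X) ^ (r + 1) * (kappaZ c' D (q ^ (r + 1)) - ((r : ℂ) + 2))‖ :=
        norm_add_le _ _
    _ ≤ 125 * ‖v * X - v * u‖ + 90 * (B * Real.log q) * ‖v * X‖ :=
        add_le_add (norm_inv_sq_sub_inv_sq_le hvX hvu) hR
    _ ≤ 125 * (10 * alpha D * Real.log q * (q : ℝ)⁻¹) +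
          90 * ((7 * alpha D) * Real.log q) * (2 * (q : ℝ)⁻¹) := by
        gcongr
    _ = 2510 * (alpha D * Real.log q / q) := by ring
    _ ≤ 2600 * (alpha D * Real.log q / q) := by
        have : 0 ≤ alpha D * Real.log q / q := by positivity
        nlinarith

/-- The Case-3 coefficients: `‖(κ(q^{r+1}) − (r+2)) − c₀(κ(q^r)w − (r+1))‖ ≤ 3B log q·(r+2)²`
for `‖c₀‖ ≤ 2`, `‖w‖ = 1`, `‖w − 1‖ ≤ B log q` (`B = |b₁|+|b₂|+|b₃|`).
[cite: Zhang2022LandauSiegel, App. A p. 103] -/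
theorem case3_coeff_bound (b₁ b₂ b₃ : ℝ) {q : ℕ} (hq : q.Prime) {c₀ w : ℂ}
    (hc₀ : ‖c₀‖ ≤ 2) (hw : ‖w‖ = 1) (hw1 : ‖w - 1‖ ≤ (|b₁| + |b₂| + |b₃|) * Real.log q) (r : ℕ) :
    ‖(kappa b₁ b₂ b₃ (q ^ (r + 1)) - ((r : ℂ) + 2)) -
        c₀ * (kappa b₁ b₂ b₃ (q ^ r) * w - ((r : ℂ) + 1))‖ ≤
      (3 * (|b₁| + |b₂| + |b₃|) * Real.log q) * ((r : ℝ) + 2) ^ 2 := by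
  set B : ℝ := |b₁| + |b₂| + |b₃| with hBdef
  have hB0 : 0 ≤ B * Real.log q := mul_nonneg (by positivity) (Real.log_natCast_nonneg q)
  have h1 : ‖kappa b₁ b₂ b₃ (q ^ (r + 1)) - ((r : ℂ) + 2)‖ ≤ (B * Real.log q) * ((r : ℝ) + 2) ^ 2 := by
    have h := norm_kappa_prime_pow_sub_le b₁ b₂ b₃ hq (r + 1)
    have e1 : (((r + 1 : ℕ) : ℂ) + 1) = (r : ℂ) + 2 := by push_cast; ring
    rw [e1] at h
    calc _ ≤ ((r + 1 : ℕ) + 1) * (r + 1 : ℕ) * B * Real.log q := h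
      _ = (B * Real.log q) * (((r : ℝ) + 2) * ((r : ℝ) + 1)) := by push_cast; ring
      _ ≤ (B * Real.log q) * ((r : ℝ) + 2) ^ 2 := by
          have hAC : ((r : ℝ) + 2) * ((r : ℝ) + 1) ≤ ((r : ℝ) + 2) ^ 2 := by
            nlinarith [(Nat.cast_nonneg r : (0 : ℝ) ≤ r)]
          exact mul_le_mul_of_nonneg_left hAC hB0
  have h2 : ‖kappa b₁ b₂ b₃ (q ^ r) * w - ((r : ℂ) + 1)‖ ≤ (B * Real.log q) * ((r : ℝ) + 2) ^ 2 := by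
    have h := norm_kappa_prime_pow_sub_le b₁ b₂ b₃ hq r
    have e2 : kappa b₁ b₂ b₃ (q ^ r) * w - ((r : ℂ) + 1) =
        (kappa b₁ b₂ b₃ (q ^ r) - ((r : ℂ) + 1)) * w + ((r : ℂ) + 1) * (w - 1) := by ring
    rw [e2]
    have hr1 : ‖((r : ℂ) + 1)‖ = (r : ℝ) + 1 := by
      rw [show ((r : ℂ) + 1) = ((r + 1 : ℕ) : ℂ) by push_cast; ring, Complex.norm_natCast]
      push_cast; ring
    calc _ ≤ ‖(kappa b₁ b₂ b₃ (q ^ r) - ((r : ℂ) + 1)) * w‖ + ‖((r : ℂ) + 1) * (w - 1)‖ :=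
          norm_add_le _ _
      _ ≤ (r + 1) * r * B * Real.log q * 1 + ((r : ℝ) + 1) * (B * Real.log q) := by
          rw [norm_mul, norm_mul, hw, hr1]
          exact add_le_add (mul_le_mul h (le_refl _) (by norm_num) (by positivity))
            (mul_le_mul_of_nonneg_left hw1 (by positivity))
      _ = (B * Real.log q) * (((r : ℝ) + 1) * r + ((r : ℝ) + 1)) := by ring
      _ ≤ (B * Real.log q) * ((r : ℝ) + 2) ^ 2 := by
          have hAC : ((r : ℝ) + 1) * r + ((r : ℝ) + 1) ≤ ((r : ℝ) + 2) ^ 2 := by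
            nlinarith [(Nat.cast_nonneg r : (0 : ℝ) ≤ r)]
          exact mul_le_mul_of_nonneg_left hAC hB0
  calc _ ≤ ‖kappa b₁ b₂ b₃ (q ^ (r + 1)) - ((r : ℂ) + 2)‖ +
        ‖c₀ * (kappa b₁ b₂ b₃ (q ^ r) * w - ((r : ℂ) + 1))‖ := norm_sub_le _ _
    _ ≤ (B * Real.log q) * ((r : ℝ) + 2) ^ 2 + 2 * ((B * Real.log q) * ((r : ℝ) + 2) ^ 2) := by
        rw [norm_mul]
        exact add_le_add h1 (mul_le_mul hc₀ h2 (norm_nonneg _) (by norm_num))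
    _ = (3 * B * Real.log q) * ((r : ℝ) + 2) ^ 2 := by ring

/-! ## Case 3: Z22:§A.u019 -/

/-- **Z22:§A.u019 holds** (App. A p. 103, tex L5081): for `q ∣ d`, `(q,h) = 1` (Case 3,
`ξ_j(q^r;d,h) = κ(q^r) − κ(q^{r−1})q^{1−β_j}/(q−1)`), `|s − 1| < 5α`, `q < D`:
`‖Σ_r χ(q^r)ξ_j(q^r;d,h)/q^{rs} − (1/(1−vu)² − 1 − vu/((1−u)(1−vu)²))‖ ≤ 6700·α log q/q` for all
large `D`. [cite: Zhang2022LandauSiegel, App. A p. 103] -/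
theorem stepA_u019_holds (c' : ℝ) : StepA_u019 c' := by
  refine ⟨6700, ⌈Real.exp (10 * |c'| * π + 400)⌉₊,
    fun D _ χ hD _ _ _ j _ d h hd hh _ q hq s hcond hqd hqh => ?_⟩
  have hD' : Real.exp (10 * |c'| * π + 400) ≤ D := le_trans (Nat.le_ceil _) (by exact_mod_cast hD)
  obtain ⟨hℓ3, hα, hB, hαℓ⟩ := largeD_bounds c' hD'
  obtain ⟨hs, hqD, _⟩ := hcond
  obtain ⟨hXu, hXn, hun, hqinv, hlogq, hlogq0⟩ := frame_X c' hD' hq hqD hs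
  set B : ℝ := |b1 c' D| + |b2 c' D| + |b3 c' D| with hBdef
  set v : ℂ := χ (q : ZMod D) with hv
  set X : ℂ := (q : ℂ) ^ (-s) with hX
  set u : ℂ := ((q : ℂ))⁻¹ with hu
  have hq0 : (q : ℂ) ≠ 0 := by exact_mod_cast hq.ne_zero
  have hvn : ‖v‖ ≤ 1 := χ.norm_le_one _
  have hvX : ‖v * X‖ ≤ 3 / 5 := by
    rw [norm_mul]; nlinarith [norm_nonneg v, norm_nonneg X]
  have hvu : ‖v * u‖ ≤ 3 / 5 := by
    rw [norm_mul]; nlinarith [norm_nonneg v, norm_nonneg u]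
  have hvXu : ‖v * X - v * u‖ ≤ 10 * alpha D * Real.log q * (q : ℝ)⁻¹ := by
    rw [← mul_sub, norm_mul]; nlinarith [norm_nonneg v, norm_nonneg (X - u)]
  have hvX2 : ‖v * X‖ ≤ 2 * (q : ℝ)⁻¹ := by
    have h1 : ‖X‖ ≤ ‖X - u‖ + ‖u‖ := by
      have := norm_add_le (X - u) u; rwa [sub_add_cancel] at this
    have h2 : ‖u‖ = (q : ℝ)⁻¹ := by rw [hu, norm_inv, Complex.norm_natCast]
    have h3 : 10 * alpha D * Real.log q * (q : ℝ)⁻¹ ≤ (q : ℝ)⁻¹ := by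
      have : 10 * alpha D * Real.log q ≤ 10 * (alpha D * ell D) := by
        calc _ ≤ 10 * alpha D * ell D := by gcongr
          _ = _ := by ring
      have hq0' : (0 : ℝ) ≤ (q : ℝ)⁻¹ := by positivity
      nlinarith
    calc ‖v * X‖ ≤ ‖X‖ := by rw [norm_mul]; nlinarith [norm_nonneg v, norm_nonneg X]
      _ ≤ 2 * (q : ℝ)⁻¹ := by linarith
  -- `c₀ = 1/(1−u)` and `w = q^{−β_j}`; `q^{1−β_j}/(q−1) = c₀ w`
  set c₀ : ℂ := 1 / (1 - u) with hc₀
  set w : ℂ := (q : ℂ) ^ (-betaJ c' D j) with hw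
  have hu1 : 1 - u ≠ 0 := by
    intro h0
    have : ‖(1 : ℂ)‖ ≤ 1 / 2 := by
      have e : (1 : ℂ) = u := by linear_combination h0
      rw [e]; exact hun
    rw [norm_one] at this; linarith
  have hc₀n : ‖c₀‖ ≤ 2 := by
    have hden : 1 / 2 ≤ ‖1 - u‖ := by
      linarith [norm_le_norm_add_norm_sub' (1 : ℂ) u, norm_one (α := ℂ)]
    rw [hc₀, norm_div, norm_one, div_le_iff₀ (by positivity)]
    linarith
  have hwn : ‖w‖ = 1 := by
    rw [hw, Complex.norm_natCast_cpow_of_pos hq.pos]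
    have : (-betaJ c' D j).re = 0 := by
      rw [Complex.neg_re]; unfold betaJ beta1 beta2 beta3; split_ifs <;> simp
    rw [this, Real.rpow_zero]
  have hw1 : ‖w - 1‖ ≤ B * Real.log q :=
    le_trans (norm_cpow_neg_betaJ_sub_one_le c' D j hq.pos)
      (mul_le_mul_of_nonneg_right (norm_betaJ_le c' D j) hlogq0)
  have hfrac : (q : ℂ) ^ (1 - betaJ c' D j) / ((q : ℂ) - 1) = c₀ * w := by
    have hq1 : (q : ℂ) - 1 ≠ 0 := by
      have : (1 : ℝ) < q := by exact_mod_cast hq.one_lt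
      intro h0
      have h1 : (q : ℂ) = 1 := by linear_combination h0
      have : (q : ℝ) = 1 := by exact_mod_cast h1
      linarith
    rw [sub_eq_add_neg (1 : ℂ), Complex.cpow_add _ _ hq0, Complex.cpow_one, hc₀, hu, hw]
    field_simp
  -- the coefficients and their main terms
  have hxi : ∀ r : ℕ, xiA c' D j (q ^ (r + 1)) d h =
      kappaZ c' D (q ^ (r + 1)) - c₀ * (kappaZ c' D (q ^ r) * w) := fun r => by
    rw [stepA_u018_eq_corrected c' D j d h q (r + 1) hd hh hq hqd hqh (by omega),
      Nat.add_sub_cancel, mul_div_assoc, hfrac]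
    ring
  have hsplit : ∀ r : ℕ, (v * X) ^ (r + 1) * xiA c' D j (q ^ (r + 1)) d h =
      (((r : ℂ) + 2) * (v * X) ^ (r + 1) - c₀ * (((r : ℂ) + 1) * (v * X) ^ (r + 1))) +
        (v * X) ^ (r + 1) * ((kappaZ c' D (q ^ (r + 1)) - ((r : ℂ) + 2)) -
          c₀ * (kappaZ c' D (q ^ r) * w - ((r : ℂ) + 1))) := fun r => by
    rw [hxi r]; ring
  have hE : ∀ r : ℕ, ‖(kappaZ c' D (q ^ (r + 1)) - ((r : ℂ) + 2)) -
      c₀ * (kappaZ c' D (q ^ r) * w - ((r : ℂ) + 1))‖ ≤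
      (3 * B * Real.log q) * ((r : ℝ) + 2) ^ 2 := fun r =>
    case3_coeff_bound (b1 c' D) (b2 c' D) (b3 c' D) hq hc₀n hwn hw1 r
  obtain ⟨hsumR, hR⟩ := tsum_pow_succ_mul_bound hvX (by positivity) hE
  have hlt : ‖v * X‖ < 1 := lt_of_le_of_lt hvX (by norm_num)
  have hmain := (hasSum_coe_add_two_mul_pow_succ hlt).sub
    ((hasSum_coe_succ_mul_pow_succ hlt).mul_left c₀)
  rw [xiPowSum_eq c' χ j d h s hq.pos]
  have htot : ∑' r : ℕ, (v * X) ^ (r + 1) * xiA c' D j (q ^ (r + 1)) d h =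
      ((1 / (1 - v * X) ^ 2 - 1) - c₀ * (v * X / (1 - v * X) ^ 2)) +
        ∑' r : ℕ, (v * X) ^ (r + 1) * ((kappaZ c' D (q ^ (r + 1)) - ((r : ℂ) + 2)) -
          c₀ * (kappaZ c' D (q ^ r) * w - ((r : ℂ) + 1))) := by
    rw [tsum_congr hsplit, hmain.summable.tsum_add hsumR, hmain.tsum_eq]
  rw [htot]
  have huA : uA q = u := rfl
  have hvA : vA χ q = v := rfl
  rw [huA, hvA]
  have e : ((1 / (1 - v * X) ^ 2 - 1) - c₀ * (v * X / (1 - v * X) ^ 2)) +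
      (∑' r : ℕ, (v * X) ^ (r + 1) * ((kappaZ c' D (q ^ (r + 1)) - ((r : ℂ) + 2)) -
          c₀ * (kappaZ c' D (q ^ r) * w - ((r : ℂ) + 1)))) -
      (1 / (1 - v * u) ^ 2 - 1 - v * u / ((1 - u) * (1 - v * u) ^ 2)) =
      (1 / (1 - v * X) ^ 2 - 1 / (1 - v * u) ^ 2) -
        c₀ * (v * X / (1 - v * X) ^ 2 - v * u / (1 - v * u) ^ 2) +
        ∑' r : ℕ, (v * X) ^ (r + 1) * ((kappaZ c' D (q ^ (r + 1)) - ((r : ℂ) + 2)) -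
          c₀ * (kappaZ c' D (q ^ r) * w - ((r : ℂ) + 1))) := by
    have hcW : v * u / ((1 - u) * (1 - v * u) ^ 2) = c₀ * (v * u / (1 - v * u) ^ 2) := by
      rw [hc₀, div_mul_div_comm, one_mul]
    rw [hcW]
    ring
  rw [e]
  calc _ ≤ ‖(1 / (1 - v * X) ^ 2 - 1 / (1 - v * u) ^ 2) -
          c₀ * (v * X / (1 - v * X) ^ 2 - v * u / (1 - v * u) ^ 2)‖ +
        ‖∑' r : ℕ, (v * X) ^ (r + 1) * ((kappaZ c' D (q ^ (r + 1)) - ((r : ℂ) + 2)) -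
          c₀ * (kappaZ c' D (q ^ r) * w - ((r : ℂ) + 1)))‖ := norm_add_le _ _
    _ ≤ (125 * ‖v * X - v * u‖ + 2 * (82 * ‖v * X - v * u‖)) +
          90 * (3 * B * Real.log q) * ‖v * X‖ := by
        refine add_le_add ?_ hR
        calc _ ≤ ‖1 / (1 - v * X) ^ 2 - 1 / (1 - v * u) ^ 2‖ +
              ‖c₀ * (v * X / (1 - v * X) ^ 2 - v * u / (1 - v * u) ^ 2)‖ := norm_sub_le _ _
          _ ≤ _ := by
              rw [norm_mul]
              exact add_le_add (norm_inv_sq_sub_inv_sq_le hvX hvu)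
                (mul_le_mul hc₀n (norm_div_sq_sub_div_sq_le hvX hvu) (norm_nonneg _) (by norm_num))
    _ ≤ (125 * (10 * alpha D * Real.log q * (q : ℝ)⁻¹) +
          2 * (82 * (10 * alpha D * Real.log q * (q : ℝ)⁻¹))) +
          90 * (3 * (7 * alpha D) * Real.log q) * (2 * (q : ℝ)⁻¹) := by
        gcongr
    _ = 6670 * (alpha D * Real.log q / q) := by ring
    _ ≤ 6700 * (alpha D * Real.log q / q) := by
        have : 0 ≤ alpha D * Real.log q / q := by positivity
        nlinarith

/-! ## The deductions "this yields (A.2) / (A.3)" and (A.2), (A.3) themselves -/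

/-- The frame constants: `t = α log q/q ≤ 1`, `‖vu‖ ≤ 1/2`, under the standing conditions for large
`D`. [cite: Zhang2022LandauSiegel, App. A p. 102] -/
theorem frame_t (c' : ℝ) {D : ℕ} (hD : Real.exp (10 * |c'| * π + 400) ≤ D) {q : ℕ} (hq : q.Prime)
    (hqD : q < D) :
    0 ≤ alpha D * Real.log q / q ∧ alpha D * Real.log q / q ≤ 1 ∧ ‖((q : ℂ))⁻¹‖ ≤ 1 / 2 := by
  obtain ⟨hℓ3, hα, _, hαℓ⟩ := largeD_bounds c' hD
  have hq2 : (2 : ℝ) ≤ q := by exact_mod_cast hq.two_le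
  have hq0 : (0 : ℝ) < q := by linarith
  have hlogq : Real.log q ≤ ell D := by
    rw [ell]; exact Real.log_le_log hq0 (by exact_mod_cast hqD.le)
  have hlogq0 : 0 ≤ Real.log q := Real.log_nonneg (by linarith)
  refine ⟨by positivity, ?_, ?_⟩
  · rw [div_le_one hq0]
    calc alpha D * Real.log q ≤ alpha D * ell D := by gcongr
      _ ≤ 1 := by linarith
      _ ≤ q := by linarith
  · rw [norm_inv, Complex.norm_natCast]; exact inv_le_of_inv_le₀ (by norm_num) (by linarith)

/-- **`DedA2` holds** ("This yields (A.2) since `λ̃(q,dh;1−β_j) = 1`", tex L5068): with `λ̃ = 1`,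
`𝔱_j = pref·(1 + Σ)`, `pref = (1−vu) + O(ε)`, `1 + Σ = 1/(1−vu)² + O(ε)` ⇒ `𝔱_j = 1/(1−vu) + O(ε)`.
[cite: Zhang2022LandauSiegel, App. A p. 103] -/
theorem dedA2_holds (c' : ℝ) : DedA2 c' := by
  intro h17 hlt h15
  obtain ⟨C₁, D₁, h₁⟩ := h17
  obtain ⟨C₃, D₃, h₃⟩ := h15
  refine ⟨|C₃| * (4 + |C₁|) + 3 / 2 * |C₁|, max (max D₁ D₃) ⌈Real.exp (10 * |c'| * π + 400)⌉₊,
    fun D _ χ hD hquad hprim hA j hj d h hd hh hdh q hq s hcond hqh => ?_⟩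
  have hD1 : D₁ ≤ D := le_trans (le_trans (le_max_left _ _) (le_max_left _ _)) hD
  have hD3 : D₃ ≤ D := le_trans (le_trans (le_max_right _ _) (le_max_left _ _)) hD
  have hD' : Real.exp (10 * |c'| * π + 400) ≤ D :=
    le_trans (Nat.le_ceil _) (by exact_mod_cast le_trans (le_max_right _ _) hD)
  have e17 := h₁ D χ hD1 hquad hprim hA j hj d h hd hh hdh q hq s hcond hqh
  have e15 := h₃ D χ hD3 hquad hprim hA j hj q hq s hcond
  have elt := hlt D j d h q hd hq hqh
  obtain ⟨ht0, ht1, hun⟩ := frame_t c' hD' hq hcond.2.1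
  set t : ℝ := alpha D * Real.log q / q with htdef
  set v : ℂ := vA χ q with hv
  set u : ℂ := uA q with hu
  have hvn : ‖v‖ ≤ 1 := χ.norm_le_one _
  have hun' : ‖u‖ ≤ 1 / 2 := hun
  have hvu : ‖v * u‖ ≤ 1 / 2 := by rw [norm_mul]; nlinarith [norm_nonneg v, norm_nonneg u]
  have hden : 1 / 2 ≤ ‖1 - v * u‖ := by
    linarith [norm_le_norm_add_norm_sub' (1 : ℂ) (v * u), norm_one (α := ℂ)]
  have hden0 : 1 - v * u ≠ 0 := fun h0 => by rw [h0, norm_zero] at hden; linarith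
  set P : ℂ := 1 - v * u with hP
  set M : ℂ := 1 / (1 - v * u) ^ 2 with hM
  have hPn : ‖P‖ ≤ 3 / 2 := by
    calc ‖P‖ ≤ ‖(1 : ℂ)‖ + ‖v * u‖ := norm_sub_le _ _
      _ ≤ 3 / 2 := by rw [norm_one]; linarith
  have hMn : ‖M‖ ≤ 4 := by
    rw [hM, norm_div, norm_one, norm_pow, div_le_iff₀ (by positivity)]
    nlinarith [pow_le_pow_left₀ (by norm_num : (0:ℝ) ≤ 1 / 2) hden 2]
  have hPM : P * M = 1 / (1 - v * u) := by rw [hP, hM]; field_simp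
  -- the two estimates
  have e15' : ‖pref c' χ j s q - P‖ ≤ |C₃| * t :=
    le_trans e15 (by rw [htdef]; exact mul_le_mul_of_nonneg_right (le_abs_self _) ht0)
  have e17' : ‖xiPowSum c' χ j d h s q - (M - 1)‖ ≤ |C₁| * t :=
    le_trans e17 (by rw [htdef]; exact mul_le_mul_of_nonneg_right (le_abs_self _) ht0)
  have hS : ‖1 + xiPowSum c' χ j d h s q‖ ≤ 4 + |C₁| := by
    have e : 1 + xiPowSum c' χ j d h s q = (xiPowSum c' χ j d h s q - (M - 1)) + M := by ring
    rw [e]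
    calc _ ≤ ‖xiPowSum c' χ j d h s q - (M - 1)‖ + ‖M‖ := norm_add_le _ _
      _ ≤ |C₁| * t + 4 := add_le_add e17' hMn
      _ ≤ 4 + |C₁| := by nlinarith [abs_nonneg C₁]
  -- assemble
  unfold frakt
  rw [elt, one_mul, ← hPM]
  have e : pref c' χ j s q * (1 + xiPowSum c' χ j d h s q) - P * M =
      (pref c' χ j s q - P) * (1 + xiPowSum c' χ j d h s q) +
        P * (xiPowSum c' χ j d h s q - (M - 1)) := by ring
  rw [e]
  calc _ ≤ ‖(pref c' χ j s q - P) * (1 + xiPowSum c' χ j d h s q)‖ +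
        ‖P * (xiPowSum c' χ j d h s q - (M - 1))‖ := norm_add_le _ _
    _ ≤ |C₃| * t * (4 + |C₁|) + 3 / 2 * (|C₁| * t) := by
        rw [norm_mul, norm_mul]
        exact add_le_add (mul_le_mul e15' hS (norm_nonneg _) (by positivity))
          (mul_le_mul hPn e17' (norm_nonneg _) (by norm_num))
    _ = (|C₃| * (4 + |C₁|) + 3 / 2 * |C₁|) * (alpha D * Real.log q / q) := by rw [htdef]; ring

/-- **`DedA3` holds** ("This yields (A.3)", tex L5083): with `λ̃ = 1`, `𝔱_j = pref·(1 + Σ)`,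
`pref = (1−vu) + O(ε)`, `1 + Σ = 1/(1−vu)² − vu/((1−u)(1−vu)²) + O(ε)` ⇒
`𝔱_j = (1−u−vu)/((1−vu)(1−u)) + O(ε)`. [cite: Zhang2022LandauSiegel, App. A p. 103] -/
theorem dedA3_holds (c' : ℝ) : DedA3 c' := by
  intro h19 hlt h15
  obtain ⟨C₁, D₁, h₁⟩ := h19
  obtain ⟨C₃, D₃, h₃⟩ := h15
  refine ⟨|C₃| * (8 + |C₁|) + 3 / 2 * |C₁|, max (max D₁ D₃) ⌈Real.exp (10 * |c'| * π + 400)⌉₊,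
    fun D _ χ hD hquad hprim hA j hj d h hd hh hdh q hq s hcond hqd hqh => ?_⟩
  have hD1 : D₁ ≤ D := le_trans (le_trans (le_max_left _ _) (le_max_left _ _)) hD
  have hD3 : D₃ ≤ D := le_trans (le_trans (le_max_right _ _) (le_max_left _ _)) hD
  have hD' : Real.exp (10 * |c'| * π + 400) ≤ D :=
    le_trans (Nat.le_ceil _) (by exact_mod_cast le_trans (le_max_right _ _) hD)
  have e19 := h₁ D χ hD1 hquad hprim hA j hj d h hd hh hdh q hq s hcond hqd hqh
  have e15 := h₃ D χ hD3 hquad hprim hA j hj q hq s hcond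
  have elt := hlt D j d h q hh hq hqd
  obtain ⟨ht0, ht1, hun⟩ := frame_t c' hD' hq hcond.2.1
  set t : ℝ := alpha D * Real.log q / q with htdef
  set v : ℂ := vA χ q with hv
  set u : ℂ := uA q with hu
  have hvn : ‖v‖ ≤ 1 := χ.norm_le_one _
  have hun' : ‖u‖ ≤ 1 / 2 := hun
  have hvu : ‖v * u‖ ≤ 1 / 2 := by rw [norm_mul]; nlinarith [norm_nonneg v, norm_nonneg u]
  have hden : 1 / 2 ≤ ‖1 - v * u‖ := by
    linarith [norm_le_norm_add_norm_sub' (1 : ℂ) (v * u), norm_one (α := ℂ)]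
  have hden0 : 1 - v * u ≠ 0 := fun h0 => by rw [h0, norm_zero] at hden; linarith
  have hdenu : 1 / 2 ≤ ‖1 - u‖ := by
    linarith [norm_le_norm_add_norm_sub' (1 : ℂ) u, norm_one (α := ℂ)]
  have hdenu0 : 1 - u ≠ 0 := fun h0 => by rw [h0, norm_zero] at hdenu; linarith
  set P : ℂ := 1 - v * u with hP
  set M : ℂ := 1 / (1 - v * u) ^ 2 - v * u / ((1 - u) * (1 - v * u) ^ 2) with hM
  have hPn : ‖P‖ ≤ 3 / 2 := by
    calc ‖P‖ ≤ ‖(1 : ℂ)‖ + ‖v * u‖ := norm_sub_le _ _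
      _ ≤ 3 / 2 := by rw [norm_one]; linarith
  have hMn : ‖M‖ ≤ 8 := by
    have h1 : ‖1 / (1 - v * u) ^ 2‖ ≤ 4 := by
      rw [norm_div, norm_one, norm_pow, div_le_iff₀ (by positivity)]
      nlinarith [pow_le_pow_left₀ (by norm_num : (0:ℝ) ≤ 1 / 2) hden 2]
    have h2 : ‖v * u / ((1 - u) * (1 - v * u) ^ 2)‖ ≤ 4 := by
      have hd : 1 / 8 ≤ ‖(1 - u) * (1 - v * u) ^ 2‖ := by
        rw [norm_mul, norm_pow]
        have := mul_le_mul hdenu (pow_le_pow_left₀ (by norm_num : (0:ℝ) ≤ 1 / 2) hden 2)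
          (by positivity) (norm_nonneg _)
        linarith
      rw [norm_div, div_le_iff₀ (by positivity)]
      linarith
    calc ‖M‖ ≤ ‖1 / (1 - v * u) ^ 2‖ + ‖v * u / ((1 - u) * (1 - v * u) ^ 2)‖ := norm_sub_le _ _
      _ ≤ 8 := by linarith
  have hPM : P * M = (1 - u - v * u) / ((1 - v * u) * (1 - u)) := by
    rw [hP, hM]; field_simp
  have e15' : ‖pref c' χ j s q - P‖ ≤ |C₃| * t :=
    le_trans e15 (by rw [htdef]; exact mul_le_mul_of_nonneg_right (le_abs_self _) ht0)
  have e19' : ‖xiPowSum c' χ j d h s q - (M - 1)‖ ≤ |C₁| * t := by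
    have e : M - 1 = 1 / (1 - v * u) ^ 2 - 1 - v * u / ((1 - u) * (1 - v * u) ^ 2) := by
      rw [hM]; ring
    rw [e]
    exact le_trans e19 (by rw [htdef]; exact mul_le_mul_of_nonneg_right (le_abs_self _) ht0)
  have hS : ‖1 + xiPowSum c' χ j d h s q‖ ≤ 8 + |C₁| := by
    have e : 1 + xiPowSum c' χ j d h s q = (xiPowSum c' χ j d h s q - (M - 1)) + M := by ring
    rw [e]
    calc _ ≤ ‖xiPowSum c' χ j d h s q - (M - 1)‖ + ‖M‖ := norm_add_le _ _
      _ ≤ |C₁| * t + 8 := add_le_add e19' hMn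
      _ ≤ 8 + |C₁| := by nlinarith [abs_nonneg C₁]
  unfold frakt
  rw [elt, one_mul, ← hPM]
  have e : pref c' χ j s q * (1 + xiPowSum c' χ j d h s q) - P * M =
      (pref c' χ j s q - P) * (1 + xiPowSum c' χ j d h s q) +
        P * (xiPowSum c' χ j d h s q - (M - 1)) := by ring
  rw [e]
  calc _ ≤ ‖(pref c' χ j s q - P) * (1 + xiPowSum c' χ j d h s q)‖ +
        ‖P * (xiPowSum c' χ j d h s q - (M - 1))‖ := norm_add_le _ _
    _ ≤ |C₃| * t * (8 + |C₁|) + 3 / 2 * (|C₁| * t) := by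
        rw [norm_mul, norm_mul]
        exact add_le_add (mul_le_mul e15' hS (norm_nonneg _) (by positivity))
          (mul_le_mul hPn e19' (norm_nonneg _) (by norm_num))
    _ = (|C₃| * (8 + |C₁|) + 3 / 2 * |C₁|) * (alpha D * Real.log q / q) := by rw [htdef]; ring

/-- **(A.2) holds** (Z22:(A.2), App. A p. 102, tex L5011): for `q ∣ h`, `|s − 1| < 5α`, `q < D`,
`(q,D) = 1`: `𝔱_j(d,h,s;q) = 1/(1−vu) + O(α log q/q)` — by `DedA2` from u017, u015 and `λ̃ = 1`.
[cite: Zhang2022LandauSiegel, App. A (A.2) p. 102] -/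
theorem eqA_2_holds (c' : ℝ) : EqA_2 c' :=
  dedA2_holds c' (stepA_u017_holds c') (stepA_u017_lamTilde_holds c') (stepA_u015_holds c')

/-- **(A.3) holds** (Z22:(A.3), App. A p. 102, tex L5015): for `q ∣ d`, `(q,h) = 1`, `|s − 1| < 5α`,
`q < D`, `(q,D) = 1`: `𝔱_j(d,h,s;q) = (1−u−vu)/((1−vu)(1−u)) + O(α log q/q)` — by `DedA3` from
u019, u015 and `λ̃ = 1`. [cite: Zhang2022LandauSiegel, App. A (A.3) p. 102] -/
theorem eqA_3_holds (c' : ℝ) : EqA_3 c' :=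
  dedA3_holds c' (stepA_u019_holds c') (stepA_u018_lamTilde_holds c') (stepA_u015_holds c')

variable (c' : ℝ) in
/-- `StepA_u017` — `_holds` alias of `stepA_u017_holds` above under the fact's exact name, stated under the
prover's own binders as section variables (appended 2026-08-28, D-0026 bookkeeping: the proof term is the
existing theorem of this file; no statement, definition or attribute is edited; no new named fact; the
ledger's debt table listed the fact unproved). [cite: Zhang2022LandauSiegel, App. A p.103 (§A.u017), tex L5066] -/
theorem _root_.Literature.NumberTheory.LFunctions.Zhang2022.Typed.AppendixA1.StepA_u017_holds :
    _root_.Literature.NumberTheory.LFunctions.Zhang2022.Typed.AppendixA1.StepA_u017 c' :=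
  stepA_u017_holds (c' := c')

variable (c' : ℝ) in
/-- `StepA_u019` — `_holds` alias of `stepA_u019_holds` above under the fact's exact name, stated under the
prover's own binders as section variables (appended 2026-08-28, D-0026 bookkeeping: the proof term is the
existing theorem of this file; no statement, definition or attribute is edited; no new named fact; the
ledger's debt table listed the fact unproved). [cite: Zhang2022LandauSiegel, App. A p.103 (§A.u019), tex L5081] -/
theorem _root_.Literature.NumberTheory.LFunctions.Zhang2022.Typed.AppendixA1.StepA_u019_holds :
    _root_.Literature.NumberTheory.LFunctions.Zhang2022.Typed.AppendixA1.StepA_u019 c' :=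
  stepA_u019_holds (c' := c')

variable (c' : ℝ) in
/-- `DedA2` — `_holds` alias of `dedA2_holds` above under the fact's exact name, stated under the
prover's own binders as section variables (appended 2026-08-28, D-0026 bookkeeping: the proof term is the
existing theorem of this file; no statement, definition or attribute is edited; no new named fact; the
ledger's debt table listed the fact unproved). [cite: Zhang2022LandauSiegel, App. A p.103, tex L5066–5068] -/
theorem _root_.Literature.NumberTheory.LFunctions.Zhang2022.Typed.AppendixA1.DedA2_holds :
    _root_.Literature.NumberTheory.LFunctions.Zhang2022.Typed.AppendixA1.DedA2 c' :=
  dedA2_holds (c' := c')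

variable (c' : ℝ) in
/-- `DedA3` — `_holds` alias of `dedA3_holds` above under the fact's exact name, stated under the
prover's own binders as section variables (appended 2026-08-28, D-0026 bookkeeping: the proof term is the
existing theorem of this file; no statement, definition or attribute is edited; no new named fact; the
ledger's debt table listed the fact unproved). [cite: Zhang2022LandauSiegel, App. A p.103, tex L5081–5083] -/
theorem _root_.Literature.NumberTheory.LFunctions.Zhang2022.Typed.AppendixA1.DedA3_holds :
    _root_.Literature.NumberTheory.LFunctions.Zhang2022.Typed.AppendixA1.DedA3 c' :=
  dedA3_holds (c' := c')

variable (c' : ℝ) in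
/-- `EqA_2` — `_holds` alias of `eqA_2_holds` above under the fact's exact name, stated under the
prover's own binders as section variables (appended 2026-08-28, D-0026 bookkeeping: the proof term is the
existing theorem of this file; no statement, definition or attribute is edited; no new named fact; the
ledger's debt table listed the fact unproved). [cite: Zhang2022LandauSiegel, App. A (A.2) p.102, tex L5011] -/
theorem _root_.Literature.NumberTheory.LFunctions.Zhang2022.Typed.AppendixA1.EqA_2_holds :
    _root_.Literature.NumberTheory.LFunctions.Zhang2022.Typed.AppendixA1.EqA_2 c' :=
  eqA_2_holds (c' := c')

variable (c' : ℝ) in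
/-- `EqA_3` — `_holds` alias of `eqA_3_holds` above under the fact's exact name, stated under the
prover's own binders as section variables (appended 2026-08-28, D-0026 bookkeeping: the proof term is the
existing theorem of this file; no statement, definition or attribute is edited; no new named fact; the
ledger's debt table listed the fact unproved). [cite: Zhang2022LandauSiegel, App. A (A.3) p.102, tex L5015] -/
theorem _root_.Literature.NumberTheory.LFunctions.Zhang2022.Typed.AppendixA1.EqA_3_holds :
    _root_.Literature.NumberTheory.LFunctions.Zhang2022.Typed.AppendixA1.EqA_3 c' :=
  eqA_3_holds (c' := c')

end Literature.NumberTheory.LFunctions.Zhang2022.Lemma83
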